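import Literature.Analysis.FluidPDE.LocalTypeISlabProfile
import HarnessLib

/-!
# Normalising the pressure of a suitable weak solution on the backward slab (Albritton–Barker 2019)

Analysis/FluidPDE proofs-layer file (theorems only; no definitions, no named facts, no `sorry`)
over `Literature/Analysis/FluidPDE/LocalTypeI.lean` (D. Albritton, T. Barker, *On local Type I
singularities of the Navier–Stokes equations and Liouville theorems*, J. Math. Fluid Mech. 21
(2019) = arXiv:1811.00502, §1, Def. 2.1, Lemma 2.2, §3).

The pressure `q` of a suitable weak solution `(v, q)` on the backward slab `ℝ³ × ℝ₋ = (-∞, 0) × ℝ³`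
is determined by the equations only up to a function of time, and need not be `L^{3/2}` up to the
final time `t = 0`; Albritton–Barker's quantity `D` (mean-free pressure) and hence `𝐈` do not see
such functions of time.  To feed a *sequence* of slab solutions with `𝐈 ≤ I` into the compactness
lemma (A–B Lemma 2.2, `SuitableCompactness`), which asks for uniform `L^{3/2}` bounds of the
pressures on parabolic balls `Q(0, a)` touching the final time, one normalises the pressure to
have mean zero on the unit ball `B(0, 1)` at every time.  This file proves that this
normalisation is harmless and gives the required bounds:

* `lintegral_enorm_setAverage_slice_rpow_le_of_subset` — Jensen–Tonelli for time-dependent ball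
  means integrated over a larger cylinder: `∫_{I × S} |[f]_B(t)|^p ≤ (|S|/|B|) ∫_{I × B} |f|^p`;
* `setAverage_sub_setAverage_self` — `⨍_s (f - ⨍_s f) = 0` (also in the junk case);
* `IsSuitableWeakSolutionOn.sub_unitBallMean_slab` — `(v, q - [q]_{B(0,1)})` is again a suitable
  weak solution on the slab (`sub_pressure`; the means are `L^{3/2}_loc` on the open slab);
* `typeIBound_sub_unitBallMean` — `𝐈` is unchanged (`cknDOsc_sub_fun_time`);
* `lintegral_pressure_le_of_unitBallMean_eq_zero` — for a normalised pressure
  (`[q]_{B(0,1)}(t) = 0` for all `t`) and `a ≥ 1`,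
  `∫_{Q(0,a)} |q|^{3/2} ≤ 2 (1 + |B_a|/|B_1|) a² D(Q(0,a); q)`: the means `[q]_{B_a}(t)` equal
  `-⨍_{B_1} (q - [q]_{B_a})(t)` and are controlled by Jensen;
* `isSuitableWeakSolutionInBall_of_slab_of_unitBallMean_eq_zero` — hence a normalised slab
  solution with a weak gradient and `𝐈 < ∞` is in the class of A–B Def. 2.1
  (`IsSuitableWeakSolutionInBall a 0`) on every `Q(0, a)`, `a ≥ 1`, with the explicit bounds
  `eLpNorm_velocity_slab_le`, `eLpNorm_pressure_slab_le` on `‖v‖_{L³(Q(0,a))}`,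
  `‖q‖_{L^{3/2}(Q(0,a))}` in terms of `𝐈` (A–B §3, the uniform estimate (3.3)).

## References

* D. Albritton, T. Barker, J. Math. Fluid Mech. 21 (2019), no. 43 = arXiv:1811.00502, §1 (the
  quantities `A, C, D, E, 𝐈`), Def. 2.1, Lemma 2.2, §3 (3.3). [AlbrittonBarker2019]
* G. Koch, N. Nadirashvili, G. Seregin, V. Šverák, Acta Math. 203 (2009) 83–105, §1 (the pressure of
  an ancient solution is determined up to a function of time). [KNSS2009]
-/

noncomputable section

open MeasureTheory Set Function Filter Topology TopologicalSpace Metric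
open scoped NNReal ENNReal

namespace Literature.Analysis.FluidPDE

/-! ### Averages -/

section Average

variable {Y : Type*} [MeasureSpace Y] [SFinite (volume : Measure Y)] {I : Set ℝ} {B S : Set Y}

/-- **Jensen–Tonelli for time-dependent means over a sub-ball.** On the cylinder `I × S`, for
`B ⊆ S` of finite measure, `1 ≤ p` and `f` a.e.-strongly measurable on `I × S`:
`∫_{I × S} ‖⨍_B f(t, ·)‖ₑ^p ≤ |S| |B|⁻¹ ∫_{I × B} ‖f‖ₑ^p` (the integrand on the left is a function
of time; slice-wise `‖⨍_B f(t,·)‖ₑ^p ≤ |B|⁻¹ ∫_B ‖f(t,·)‖ₑ^p`, `enorm_setAverage_rpow_le`). [folklore] -/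
theorem lintegral_enorm_setAverage_slice_rpow_le_of_subset
    (hBtop : volume B ≠ ∞) (hBS : B ⊆ S) {f : ℝ → Y → ℝ} {p : ℝ} (hp : 1 ≤ p)
    (hf : AEStronglyMeasurable (uncurry f) (volume.restrict (I ×ˢ S))) :
    ∫⁻ w in I ×ˢ S, ‖⨍ y in B, f w.1 y‖ₑ ^ p ≤
      volume S * (volume B)⁻¹ * ∫⁻ w in I ×ˢ B, ‖f w.1 w.2‖ₑ ^ p := by
  have hfB : AEStronglyMeasurable (uncurry f) ((volume.restrict I).prod (volume.restrict B)) := by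
    rw [← volume_restrict_prod_eq]
    exact hf.mono_measure (Measure.restrict_mono (prod_mono Subset.rfl hBS) le_rfl)
  -- measurability of the slice means
  have hFm : AEStronglyMeasurable (fun t : ℝ => ⨍ y in B, f t y) (volume.restrict I) := by
    have h := hfB.integral_prod_right'
    simp only [uncurry_apply_pair] at h
    simp_rw [setAverage_eq]
    exact h.const_smul ((volume : Measure Y).real B)⁻¹
  set F : ℝ → ℝ≥0∞ := fun t => ‖⨍ y in B, f t y‖ₑ ^ p with hF
  have hFam : AEMeasurable F (volume.restrict I) := hFm.aemeasurable.enorm.pow_const p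
  -- the left-hand side as an iterated integral
  have hL : ∫⁻ w in I ×ˢ S, ‖⨍ y in B, f w.1 y‖ₑ ^ p = (∫⁻ t in I, F t) * volume S := by
    rw [volume_restrict_prod_eq]
    have hm : AEMeasurable (fun w : ℝ × Y => F w.1)
        ((volume.restrict I).prod (volume.restrict S)) :=
      hFam.comp_quasiMeasurePreserving Measure.quasiMeasurePreserving_fst
    have e : (fun w : ℝ × Y => ‖⨍ y in B, f w.1 y‖ₑ ^ p) = fun w => F w.1 := rfl
    rw [e, lintegral_prod _ hm]
    simp only [lintegral_const, Measure.restrict_apply_univ]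
    exact lintegral_mul_const'' _ hFam
  -- slice-wise Jensen
  have hJ : ∫⁻ t in I, F t ≤ (volume B)⁻¹ * ∫⁻ w in I ×ˢ B, ‖f w.1 w.2‖ₑ ^ p := by
    have hRm : AEMeasurable (fun w : ℝ × Y => ‖f w.1 w.2‖ₑ ^ p)
        ((volume.restrict I).prod (volume.restrict B)) := hfB.aemeasurable.enorm.pow_const _
    rw [volume_restrict_prod_eq, lintegral_prod _ hRm, ← lintegral_const_mul'' _ hRm.lintegral_prod_right']
    refine lintegral_mono_ae ?_
    filter_upwards [hfB.prodMk_left] with t ht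
    exact enorm_setAverage_rpow_le hBtop hp ht
  calc ∫⁻ w in I ×ˢ S, ‖⨍ y in B, f w.1 y‖ₑ ^ p = (∫⁻ t in I, F t) * volume S := hL
    _ ≤ ((volume B)⁻¹ * ∫⁻ w in I ×ˢ B, ‖f w.1 w.2‖ₑ ^ p) * volume S := by gcongr
    _ = volume S * (volume B)⁻¹ * ∫⁻ w in I ×ˢ B, ‖f w.1 w.2‖ₑ ^ p := by ring

omit [SFinite (volume : Measure Y)] in
/-- **`⨍_s (f - ⨍_s f) = 0`** for a set of finite measure, including the junk cases (`μ s = 0`,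
or `f` not integrable on `s`, where both means vanish). [folklore] -/
theorem setAverage_sub_setAverage_self {α : Type*} [MeasurableSpace α] {μ : Measure α} {s : Set α}
    (hs : μ s ≠ ∞) (f : α → ℝ) : ⨍ x in s, (f x - ⨍ y in s, f y ∂μ) ∂μ = 0 := by
  rcases eq_or_ne (μ s) 0 with hs0 | hs0
  · have h0 : μ.restrict s = 0 := Measure.restrict_eq_zero.2 hs0
    simp [h0]
  by_cases hf : IntegrableOn f s μ
  · rw [FunctionSpaces.setAverage_sub_const hs0 hs hf, sub_self]
  · have hf' : ¬ IntegrableOn (fun x => f x - ⨍ y in s, f y ∂μ) s μ := by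
      intro h
      have hc : IntegrableOn (fun _ : α => ⨍ y in s, f y ∂μ) s μ := integrableOn_const hs
      have h2 := h.add hc
      have e : ((fun x => f x - ⨍ y in s, f y ∂μ) + fun _ : α => ⨍ y in s, f y ∂μ) = f := by
        funext x; simp
      rw [e] at h2
      exact hf h2
    rw [setAverage_eq, integral_undef hf', smul_zero]

end Average

/-! ### The unit-ball means of the slab pressure -/

section Slab

variable {u : ℝ → EuclideanSpace ℝ (Fin 3) → EuclideanSpace ℝ (Fin 3)}
  {p : ℝ → EuclideanSpace ℝ (Fin 3) → ℝ}
  {G : ℝ → EuclideanSpace ℝ (Fin 3) → EuclideanSpace ℝ (Fin 3) →L[ℝ] EuclideanSpace ℝ (Fin 3)}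

/-- **Compact subsets of the slab lie in compact cylinders `T × B̄(0, ρ)` of the slab**, with
`T = fst '' K` and `ρ ≥ 1`; moreover `K ⊆ T × B(0, ρ)`. [folklore] -/
theorem exists_cylinder_of_isCompact_subset_slab {K : Set (ℝ × EuclideanSpace ℝ (Fin 3))} (hK : IsCompact K)
    (hKs : K ⊆ (Iio (0 : ℝ) ×ˢ (univ : Set (EuclideanSpace ℝ (Fin 3))))) :
    ∃ ρ : ℝ, 1 ≤ ρ ∧ K ⊆ (Prod.fst '' K) ×ˢ ball (0 : EuclideanSpace ℝ (Fin 3)) ρ ∧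
      IsCompact (Prod.fst '' K) ∧
      (Prod.fst '' K) ×ˢ closedBall (0 : EuclideanSpace ℝ (Fin 3)) ρ ⊆
        (Iio (0 : ℝ) ×ˢ (univ : Set (EuclideanSpace ℝ (Fin 3)))) := by
  obtain ⟨ρ, hρ1, hρ⟩ := (hK.image continuous_snd).isBounded.subset_ball_lt 1 (0 : EuclideanSpace ℝ (Fin 3))
  refine ⟨ρ, hρ1.le, fun w hw => ⟨mem_image_of_mem _ hw, hρ (mem_image_of_mem _ hw)⟩,
    hK.image continuous_fst, ?_⟩
  rintro ⟨t, x⟩ ⟨⟨w, hw, hwt⟩, -⟩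
  have h := hKs hw
  exact ⟨by rw [← hwt]; exact h.1, mem_univ _⟩

/-- **The unit-ball means of the slab pressure are `L^{3/2}` on compact subsets of the slab.**
For `q ∈ L^{3/2}_loc` of the open slab (the pressure class of a suitable weak solution) and a
compact `K` in the slab, the function `(t, x) ↦ [q]_{B(0,1)}(t) = ⨍_{B(0,1)} q(t, y) dy` is
a.e.-strongly measurable on `K` with `∫_K |[q]_{B(0,1)}(t)|^{3/2} < ∞` (Jensen–Tonelli on the
cylinder `T × B(0, ρ) ⊇ K` of the slab, `lintegral_enorm_setAverage_slice_rpow_le_of_subset`).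
[folklore] -/
theorem unitBallMean_class_of_isCompact
    (hsw : IsSuitableWeakSolutionOn (slab (EuclideanSpace ℝ (Fin 3)) (Iio (0 : ℝ)) isOpen_Iio) 1 0 u p)
    {K : Set (ℝ × EuclideanSpace ℝ (Fin 3))} (hK : IsCompact K)
    (hKs : K ⊆ (Iio (0 : ℝ) ×ˢ (univ : Set (EuclideanSpace ℝ (Fin 3))))) :
    AEStronglyMeasurable (fun z : ℝ × EuclideanSpace ℝ (Fin 3) =>
        ⨍ y in ball (0 : EuclideanSpace ℝ (Fin 3)) 1, p z.1 y) (volume.restrict K) ∧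
      ∫⁻ z in K, ‖⨍ y in ball (0 : EuclideanSpace ℝ (Fin 3)) 1, p z.1 y‖ₑ ^ (3 / 2 : ℝ) < ∞ := by
  obtain ⟨ρ, hρ1, hKT, hTc, hTs⟩ := exists_cylinder_of_isCompact_subset_slab hK hKs
  set T : Set ℝ := Prod.fst '' K with hT
  have hBS : ball (0 : EuclideanSpace ℝ (Fin 3)) 1 ⊆ ball (0 : EuclideanSpace ℝ (Fin 3)) ρ := ball_subset_ball hρ1
  have hsub : T ×ˢ ball (0 : EuclideanSpace ℝ (Fin 3)) ρ ⊆ T ×ˢ closedBall (0 : EuclideanSpace ℝ (Fin 3)) ρ :=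
    prod_mono Subset.rfl ball_subset_closedBall
  have hK'c : IsCompact (T ×ˢ closedBall (0 : EuclideanSpace ℝ (Fin 3)) ρ) := hTc.prod (isCompact_closedBall _ _)
  have hli : LocallyIntegrableOn (uncurry p) (Iio (0 : ℝ) ×ˢ (univ : Set (EuclideanSpace ℝ (Fin 3))))
      volume := hsw.distributional.2.2.1
  have hpm : AEStronglyMeasurable (uncurry p) (volume.restrict (T ×ˢ ball (0 : EuclideanSpace ℝ (Fin 3)) ρ)) :=
    hli.aestronglyMeasurable.mono_measure (Measure.restrict_mono (hsub.trans hTs) le_rfl)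
  -- measurability of the means on the cylinder
  have hmeas : AEStronglyMeasurable
      (fun z : ℝ × EuclideanSpace ℝ (Fin 3) => ⨍ y in ball (0 : EuclideanSpace ℝ (Fin 3)) 1, p z.1 y)
      (volume.restrict (T ×ˢ ball (0 : EuclideanSpace ℝ (Fin 3)) ρ)) := by
    have hpB : AEStronglyMeasurable (uncurry p)
        ((volume.restrict T).prod (volume.restrict (ball (0 : EuclideanSpace ℝ (Fin 3)) 1))) := by
      rw [← volume_restrict_prod_eq]
      exact hpm.mono_measure (Measure.restrict_mono (prod_mono Subset.rfl hBS) le_rfl)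
    have h := hpB.integral_prod_right'
    simp only [uncurry_apply_pair] at h
    have h' : AEStronglyMeasurable (fun t : ℝ => ⨍ y in ball (0 : EuclideanSpace ℝ (Fin 3)) 1, p t y)
        (volume.restrict T) := by
      simp_rw [setAverage_eq]
      exact h.const_smul ((volume : Measure (EuclideanSpace ℝ (Fin 3))).real (ball (0 : EuclideanSpace ℝ (Fin 3)) 1))⁻¹
    rw [volume_restrict_prod_eq]
    exact h'.comp_quasiMeasurePreserving Measure.quasiMeasurePreserving_fst
  refine ⟨hmeas.mono_measure (Measure.restrict_mono hKT le_rfl), ?_⟩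
  have hJ := lintegral_enorm_setAverage_slice_rpow_le_of_subset (I := T)
    (measure_ball_lt_top (x := (0 : EuclideanSpace ℝ (Fin 3))) (r := 1)).ne hBS
    (by norm_num : (1 : ℝ) ≤ 3 / 2) hpm
  refine lt_of_le_of_lt (lintegral_mono_set hKT) (lt_of_le_of_lt hJ ?_)
  refine ENNReal.mul_lt_top (ENNReal.mul_lt_top measure_ball_lt_top
    (ENNReal.inv_lt_top.2 (measure_ball_pos volume (0 : EuclideanSpace ℝ (Fin 3)) one_pos))) ?_
  refine lt_of_le_of_lt (lintegral_mono_set ((prod_mono Subset.rfl hBS).trans hsub)) ?_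
  exact hsw.pressure _ hTs hK'c

/-- **Normalising the pressure on the slab is harmless for suitability.** If `(v, q)` is a
suitable weak solution of Navier–Stokes (`ν = 1`, `f = 0`) on the backward slab `(-∞, 0) × ℝ³`,
so is `(v, q - [q]_{B(0,1)})`, the pressure shifted by its time-dependent unit-ball mean (a
function of time in `L^{3/2}_loc` of the open slab, `IsSuitableWeakSolutionOn.sub_pressure`; the
pressure of an ancient solution is determined only up to a function of time, KNSS 2009, §1).
[folklore] -/
theorem IsSuitableWeakSolutionOn.sub_unitBallMean_slab
    (hsw : IsSuitableWeakSolutionOn (slab (EuclideanSpace ℝ (Fin 3)) (Iio (0 : ℝ)) isOpen_Iio) 1 0 u p) :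
    IsSuitableWeakSolutionOn (slab (EuclideanSpace ℝ (Fin 3)) (Iio (0 : ℝ)) isOpen_Iio) 1 0 u
      (fun t x => p t x - ⨍ y in ball (0 : EuclideanSpace ℝ (Fin 3)) 1, p t y) := by
  refine hsw.sub_pressure ?_ fun K hKs hK => (unitBallMean_class_of_isCompact hsw hK hKs).2
  refine (locallyIntegrableOn_iff (slab (EuclideanSpace ℝ (Fin 3)) (Iio (0 : ℝ)) isOpen_Iio).isOpen.isLocallyClosed).2
    fun K hKs hK => ?_
  obtain ⟨hm, hfin⟩ := unitBallMean_class_of_isCompact hsw hK hKs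
  obtain ⟨h32, h32', h32r⟩ := threeHalves_facts
  haveI : IsFiniteMeasure (volume.restrict K) := ⟨by
    rw [Measure.restrict_apply_univ]; exact hK.measure_lt_top⟩
  have hmem : MemLp (fun z : ℝ × EuclideanSpace ℝ (Fin 3) =>
      ⨍ y in ball (0 : EuclideanSpace ℝ (Fin 3)) 1, p z.1 y) (3 / 2) (volume.restrict K) := by
    refine ⟨hm, ?_⟩
    rw [eLpNorm_eq_lintegral_rpow_enorm_toReal (zero_lt_one.trans_le h32).ne' h32', h32r]
    exact ENNReal.rpow_lt_top_of_nonneg (by positivity) hfin.ne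
  exact hmem.integrable h32

/-- **`(A + C + D + E)(Q(z, r))` does not see the normalisation** on balls of the lower half
space: `D(Q(z,r); q - [q]_{B(0,1)}) = D(Q(z,r); q)` as soon as the slices `q(t, ·)` are
integrable on `B(x, r)` for a.e. `t` (`cknDOsc_sub_fun_time`), which holds for the
`L^1_loc`-pressure of the open slab even for balls touching the final time
(`ae_integrableOn_slice_of_locallyIntegrableOn_slab`). [cite: AlbrittonBarker2019, §1] -/
theorem abScaledSum_sub_unitBallMean
    (hp : LocallyIntegrableOn (uncurry p) (Iio (0 : ℝ) ×ˢ (univ : Set (EuclideanSpace ℝ (Fin 3)))) volume)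
    {r : ℝ} (hr : 0 < r) {z : ℝ × EuclideanSpace ℝ (Fin 3)} (hz : z.1 ≤ 0) :
    abScaledSum r z u (fun t x => p t x - ⨍ y in ball (0 : EuclideanSpace ℝ (Fin 3)) 1, p t y) G =
      abScaledSum r z u p G := by
  unfold abScaledSum
  rw [cknDOsc_sub_fun_time hr _ (ae_integrableOn_slice_of_locallyIntegrableOn_slab hp hz)]

/-- **Albritton–Barker's `𝐈 = 𝐈(ℝ³ × ℝ₋)` is unchanged by the normalisation of the pressure**
(every admissible ball has `t ≤ 0`). [cite: AlbrittonBarker2019, §1] -/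
theorem typeIBound_sub_unitBallMean
    (hp : LocallyIntegrableOn (uncurry p) (Iio (0 : ℝ) ×ˢ (univ : Set (EuclideanSpace ℝ (Fin 3)))) volume) :
    typeIBound (Iio (0 : ℝ) ×ˢ (univ : Set (EuclideanSpace ℝ (Fin 3)))) u
        (fun t x => p t x - ⨍ y in ball (0 : EuclideanSpace ℝ (Fin 3)) 1, p t y) G =
      typeIBound (Iio (0 : ℝ) ×ˢ (univ : Set (EuclideanSpace ℝ (Fin 3)))) u p G := by
  unfold typeIBound
  refine iSup_congr fun r => iSup_congr fun hr => iSup_congr fun z => iSup_congr fun hz => ?_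
  refine abScaledSum_sub_unitBallMean hp hr ?_
  -- an admissible ball has `t ≤ 0`: the points `(t - ε, x)` lie in it
  by_contra h
  push Not at h
  set ε := min (r ^ 2 / 2) (z.1 / 2) with hε
  have hε1 : ε ≤ r ^ 2 / 2 := min_le_left _ _
  have hε2 : ε ≤ z.1 / 2 := min_le_right _ _
  have hε0 : 0 < ε := lt_min (by positivity) (by linarith)
  have hw : (z.1 - ε, z.2) ∈ parabolicCylinder r z := by
    rw [mem_parabolicCylinder]
    exact ⟨⟨by dsimp only; nlinarith [sq_nonneg r], by dsimp only; linarith⟩, by simpa using hr⟩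
  have : z.1 - ε < 0 := (hz hw).1
  linarith

/-- **The normalised pressure has mean zero on `B(0, 1)` at every time** (including the junk
case of a non-integrable slice, where both means vanish). [folklore] -/
theorem unitBallMean_sub_unitBallMean (p : ℝ → EuclideanSpace ℝ (Fin 3) → ℝ) (t : ℝ) :
    ⨍ y in ball (0 : EuclideanSpace ℝ (Fin 3)) 1, (p t y - ⨍ y' in ball (0 : EuclideanSpace ℝ (Fin 3)) 1, p t y') = 0 :=
  setAverage_sub_setAverage_self measure_ball_lt_top.ne (p t)

/-! ### Normalised slab pressures are `L^{3/2}` up to the final time -/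

/-- **`L^{3/2}(Q(0, a))` bound for a normalised slab pressure.**  If `q ∈ L¹_loc` of the open
slab has unit-ball mean zero at every time, then for `a ≥ 1`
`∫_{Q(0,a)} |q|^{3/2} ≤ 2 (1 + |B_a| |B_1|⁻¹) a² D(Q(0,a); q)`: on a.e. time slice
`[q]_{B_a}(t) = -⨍_{B_1} (q - [q]_{B_a}(t))`, so by Jensen–Tonelli
(`lintegral_enorm_setAverage_slice_rpow_le_of_subset`)
`∫_{Q(0,a)} |[q]_{B_a}|^{3/2} ≤ |B_a| |B_1|⁻¹ ∫_{Q(0,a)} |q - [q]_{B_a}|^{3/2} = |B_a| |B_1|⁻¹ a² D`,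
and `|q|^{3/2} ≤ 2 (|q - [q]_{B_a}|^{3/2} + |[q]_{B_a}|^{3/2})` (Albritton–Barker 2019, §3: the
uniform bound (3.3) controls the pressures of Lemma 2.2 after normalisation).
[cite: AlbrittonBarker2019, §3] -/
theorem lintegral_pressure_le_of_unitBallMean_eq_zero
    (hp : LocallyIntegrableOn (uncurry p) (Iio (0 : ℝ) ×ˢ (univ : Set (EuclideanSpace ℝ (Fin 3)))) volume)
    (h0 : ∀ t, ⨍ y in ball (0 : EuclideanSpace ℝ (Fin 3)) 1, p t y = 0) {a : ℝ} (ha : 1 ≤ a) :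
    ∫⁻ w in parabolicCylinder a (0 : ℝ × EuclideanSpace ℝ (Fin 3)), ‖p w.1 w.2‖ₑ ^ (3 / 2 : ℝ) ≤
      2 * (1 + volume (ball (0 : EuclideanSpace ℝ (Fin 3)) a) * (volume (ball (0 : EuclideanSpace ℝ (Fin 3)) 1))⁻¹) *
        (ENNReal.ofReal a ^ 2 * cknDOsc a 0 p) := by
  have ha0 : 0 < a := one_pos.trans_le ha
  set I : Set ℝ := Ioo (-a ^ 2) 0 with hI
  set Ba : Set (EuclideanSpace ℝ (Fin 3)) := ball (0 : EuclideanSpace ℝ (Fin 3)) a with hBa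
  set B1 : Set (EuclideanSpace ℝ (Fin 3)) := ball (0 : EuclideanSpace ℝ (Fin 3)) 1 with hB1
  have hB1a : B1 ⊆ Ba := ball_subset_ball ha
  have hQ : parabolicCylinder a (0 : ℝ × EuclideanSpace ℝ (Fin 3)) = I ×ˢ Ba := by
    simp [parabolicCylinder, hI, hBa]
  set m : ℝ → ℝ := fun t => ⨍ y in Ba, p t y with hm
  -- the mean-free part: `∫_Q ‖q - [q]_{B_a}‖^{3/2} = a² D`
  have hD : ∫⁻ w in parabolicCylinder a (0 : ℝ × EuclideanSpace ℝ (Fin 3)), ‖p w.1 w.2 - m w.1‖ₑ ^ (3 / 2 : ℝ) =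
      ENNReal.ofReal a ^ 2 * cknDOsc a 0 p := by
    have ha2 : ENNReal.ofReal a ^ 2 ≠ 0 := pow_ne_zero _ (ENNReal.ofReal_pos.2 ha0).ne'
    have ha2' : ENNReal.ofReal a ^ 2 ≠ ∞ := ENNReal.pow_ne_top ENNReal.ofReal_ne_top
    unfold cknDOsc
    rw [← mul_assoc, ENNReal.mul_inv_cancel ha2 ha2', one_mul]
    rfl
  -- slices of the pressure are integrable on `B_a` for a.e. time
  have hslice : ∀ᵐ t ∂(volume.restrict I), IntegrableOn (p t) Ba volume := by
    have h := ae_integrableOn_slice_of_locallyIntegrableOn_slab hp (r := a) (z := (0 : ℝ × EuclideanSpace ℝ (Fin 3)))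
      le_rfl
    simpa [hI] using h
  -- the means are averages over `B_1` of the mean-free part
  have hmean : ∀ᵐ t ∂(volume.restrict I), ‖m t‖ₑ = ‖⨍ y in B1, (p t y - m t)‖ₑ := by
    filter_upwards [hslice] with t ht
    rw [FunctionSpaces.setAverage_sub_const (measure_ball_pos volume (0 : EuclideanSpace ℝ (Fin 3)) one_pos).ne'
      measure_ball_lt_top.ne (ht.mono_set hB1a) (m t), h0 t, zero_sub, enorm_neg]
  -- measurability on the cylinder
  have hpm : AEStronglyMeasurable (uncurry p) (volume.restrict (I ×ˢ Ba)) := by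
    rw [← hQ]
    exact hp.aestronglyMeasurable.mono_measure
      (Measure.restrict_mono (parabolicCylinder_subset_slab a le_rfl) le_rfl)
  have hfm : AEStronglyMeasurable (uncurry fun t y => p t y - m t) (volume.restrict (I ×ˢ Ba)) := by
    have hmm := aestronglyMeasurable_setAverage_slice hpm
    have e : uncurry (fun t y => p t y - m t) = uncurry p - fun w : ℝ × EuclideanSpace ℝ (Fin 3) => m w.1 := rfl
    rw [e]
    exact hpm.sub hmm
  -- the means, integrated over `Q(0, a)`
  have h2 : ∫⁻ w in parabolicCylinder a (0 : ℝ × EuclideanSpace ℝ (Fin 3)), ‖m w.1‖ₑ ^ (3 / 2 : ℝ) ≤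
      volume Ba * (volume B1)⁻¹ * (ENNReal.ofReal a ^ 2 * cknDOsc a 0 p) := by
    have e : ∫⁻ w in I ×ˢ Ba, ‖m w.1‖ₑ ^ (3 / 2 : ℝ) =
        ∫⁻ w in I ×ˢ Ba, ‖⨍ y in B1, (p w.1 y - m w.1)‖ₑ ^ (3 / 2 : ℝ) := by
      refine lintegral_congr_ae ?_
      rw [volume_restrict_prod_eq]
      filter_upwards [(Measure.quasiMeasurePreserving_fst (μ := volume.restrict I)
        (ν := volume.restrict Ba)).ae hmean] with w hw
      rw [hw]
    rw [hQ, e]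
    refine (lintegral_enorm_setAverage_slice_rpow_le_of_subset measure_ball_lt_top.ne hB1a
      (by norm_num) hfm).trans ?_
    gcongr
    rw [← hD, hQ]
    exact lintegral_mono_set (prod_mono Subset.rfl hB1a)
  -- pointwise splitting `|q|^{3/2} ≤ 2 (|q - m|^{3/2} + |m|^{3/2})`
  have hpt : ∀ w : ℝ × EuclideanSpace ℝ (Fin 3), ‖p w.1 w.2‖ₑ ^ (3 / 2 : ℝ) ≤
      2 * (‖p w.1 w.2 - m w.1‖ₑ ^ (3 / 2 : ℝ) + ‖m w.1‖ₑ ^ (3 / 2 : ℝ)) := by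
    intro w
    have h1 : ‖p w.1 w.2‖ₑ ≤ ‖p w.1 w.2 - m w.1‖ₑ + ‖m w.1‖ₑ := by
      calc ‖p w.1 w.2‖ₑ = ‖(p w.1 w.2 - m w.1) + m w.1‖ₑ := by rw [sub_add_cancel]
        _ ≤ ‖p w.1 w.2 - m w.1‖ₑ + ‖m w.1‖ₑ := enorm_add_le _ _
    have h22 : (2 : ℝ≥0∞) ^ ((3 / 2 : ℝ) - 1) ≤ 2 := by
      conv_rhs => rw [← ENNReal.rpow_one 2]
      exact ENNReal.rpow_le_rpow_of_exponent_le (by norm_num) (by norm_num)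
    calc ‖p w.1 w.2‖ₑ ^ (3 / 2 : ℝ) ≤ (‖p w.1 w.2 - m w.1‖ₑ + ‖m w.1‖ₑ) ^ (3 / 2 : ℝ) := by gcongr
      _ ≤ 2 ^ ((3 / 2 : ℝ) - 1) * (‖p w.1 w.2 - m w.1‖ₑ ^ (3 / 2 : ℝ) + ‖m w.1‖ₑ ^ (3 / 2 : ℝ)) :=
          ENNReal.rpow_add_le_mul_rpow_add_rpow _ _ (by norm_num)
      _ ≤ 2 * (‖p w.1 w.2 - m w.1‖ₑ ^ (3 / 2 : ℝ) + ‖m w.1‖ₑ ^ (3 / 2 : ℝ)) := by gcongr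
  have hfam : AEMeasurable (fun w : ℝ × EuclideanSpace ℝ (Fin 3) => ‖p w.1 w.2 - m w.1‖ₑ ^ (3 / 2 : ℝ))
      (volume.restrict (parabolicCylinder a (0 : ℝ × EuclideanSpace ℝ (Fin 3)))) := by
    rw [hQ]
    exact hfm.aemeasurable.enorm.pow_const _
  calc ∫⁻ w in parabolicCylinder a (0 : ℝ × EuclideanSpace ℝ (Fin 3)), ‖p w.1 w.2‖ₑ ^ (3 / 2 : ℝ)
      ≤ ∫⁻ w in parabolicCylinder a (0 : ℝ × EuclideanSpace ℝ (Fin 3)),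
          2 * (‖p w.1 w.2 - m w.1‖ₑ ^ (3 / 2 : ℝ) + ‖m w.1‖ₑ ^ (3 / 2 : ℝ)) :=
        lintegral_mono fun w => hpt w
    _ = 2 * ((∫⁻ w in parabolicCylinder a (0 : ℝ × EuclideanSpace ℝ (Fin 3)),
            ‖p w.1 w.2 - m w.1‖ₑ ^ (3 / 2 : ℝ)) +
          ∫⁻ w in parabolicCylinder a (0 : ℝ × EuclideanSpace ℝ (Fin 3)), ‖m w.1‖ₑ ^ (3 / 2 : ℝ)) := by
        rw [lintegral_const_mul' _ _ (by norm_num), lintegral_add_left' hfam]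
    _ ≤ 2 * (ENNReal.ofReal a ^ 2 * cknDOsc a 0 p +
          volume Ba * (volume B1)⁻¹ * (ENNReal.ofReal a ^ 2 * cknDOsc a 0 p)) := by
        rw [hD]
        gcongr
    _ = 2 * (1 + volume Ba * (volume B1)⁻¹) * (ENNReal.ofReal a ^ 2 * cknDOsc a 0 p) := by ring

/-- The constant of `lintegral_pressure_le_of_unitBallMean_eq_zero` is finite. [folklore] -/
theorem pressureConst_lt_top (a : ℝ) :
    2 * (1 + volume (ball (0 : EuclideanSpace ℝ (Fin 3)) a) *
      (volume (ball (0 : EuclideanSpace ℝ (Fin 3)) 1))⁻¹) * ENNReal.ofReal a ^ 2 < ∞ := by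
  refine ENNReal.mul_lt_top (ENNReal.mul_lt_top (by simp) ?_) (ENNReal.pow_lt_top ENNReal.ofReal_lt_top)
  exact ENNReal.add_lt_top.2 ⟨ENNReal.one_lt_top, ENNReal.mul_lt_top measure_ball_lt_top
    (ENNReal.inv_lt_top.2 (measure_ball_pos volume (0 : EuclideanSpace ℝ (Fin 3)) one_pos))⟩

/-! ### Normalised slab solutions with `𝐈 < ∞` are in the class of A–B Def. 2.1 on `Q(0, a)` -/

/-- **A normalised slab solution with `𝐈 < ∞` is a suitable weak solution in the parabolic ball
`Q(0, a)` in the sense of Albritton–Barker's Def. 2.1**, `a ≥ 1`: the local notion restricts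
(`of_le`), the global energy and gradient classes on the ball follow from `A(Q(0,a)) ≤ 𝐈`,
`E(Q(0,a)) ≤ 𝐈`, and the pressure is in `L^{3/2}(Q(0,a))` by
`lintegral_pressure_le_of_unitBallMean_eq_zero` and `D(Q(0,a)) ≤ 𝐈` (A–B §3: the zoomed/shifted
suitable weak solutions with the uniform estimate (3.3) satisfy the hypotheses of Lemma 2.2).
[cite: AlbrittonBarker2019, Def. 2.1 and §3] -/
theorem isSuitableWeakSolutionInBall_of_slab
    (hsw : IsSuitableWeakSolutionOn (slab (EuclideanSpace ℝ (Fin 3)) (Iio (0 : ℝ)) isOpen_Iio) 1 0 u p)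
    (hwg : HasWeakSpatialGradientOn (slab (EuclideanSpace ℝ (Fin 3)) (Iio (0 : ℝ)) isOpen_Iio) u G)
    (hI : typeIBound (Iio (0 : ℝ) ×ˢ (univ : Set (EuclideanSpace ℝ (Fin 3)))) u p G ≠ ∞)
    (h0 : ∀ t, ⨍ y in ball (0 : EuclideanSpace ℝ (Fin 3)) 1, p t y = 0) {a : ℝ} (ha : 1 ≤ a) :
    IsSuitableWeakSolutionInBall a 0 u p := by
  obtain ⟨h32, h32', h32r⟩ := threeHalves_facts
  have ha0 : 0 < a := one_pos.trans_le ha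
  set I₀ := typeIBound (Iio (0 : ℝ) ×ˢ (univ : Set (EuclideanSpace ℝ (Fin 3)))) u p G with hIdef
  have hle : parabolicCylinderOpens a (0 : ℝ × EuclideanSpace ℝ (Fin 3)) ≤
      (slab (EuclideanSpace ℝ (Fin 3)) (Iio (0 : ℝ)) isOpen_Iio) := parabolicCylinderOpens_le_slab a le_rfl
  have hsub : parabolicCylinder a (0 : ℝ × EuclideanSpace ℝ (Fin 3)) ⊆
      Iio (0 : ℝ) ×ˢ (univ : Set (EuclideanSpace ℝ (Fin 3))) :=
    parabolicCylinder_subset_lowerHalf le_rfl a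
  have hbound : abScaledSum a 0 u p G ≤ I₀ := abScaledSum_le_typeIBound ha0 hsub
  have hra0 : ENNReal.ofReal a ≠ 0 := (ENNReal.ofReal_pos.2 ha0).ne'
  have hratop : ENNReal.ofReal a ≠ ∞ := ENNReal.ofReal_ne_top
  refine ⟨hsw.of_le hle, ?_, ⟨G, hwg.mono hle, ?_⟩, ?_⟩
  · -- the global energy class on the ball: `A(Q(0,a)) ≤ 𝐈`
    refine ⟨(ENNReal.ofReal a * I₀).toNNReal, ?_⟩
    have hA := cknAEss_le_abScaledSum.trans hbound
    unfold cknAEss at hA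
    filter_upwards [ENNReal.ae_le_essSup fun t : ℝ =>
      (ENNReal.ofReal a)⁻¹ * ∫⁻ x in ball (0 : ℝ × EuclideanSpace ℝ (Fin 3)).2 a, ‖u t x‖ₑ ^ 2] with t ht
    rw [ENNReal.coe_toNNReal (ENNReal.mul_ne_top hratop hI)]
    exact (ENNReal.inv_mul_le_iff hra0 hratop).1 (ht.trans hA)
  · -- the gradient is square integrable on the ball: `E(Q(0,a)) ≤ 𝐈`
    have hE := cknE_le_abScaledSum.trans hbound
    unfold cknE at hE
    exact lt_of_le_of_lt ((ENNReal.inv_mul_le_iff hra0 hratop).1 hE)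
      (ENNReal.mul_lt_top ENNReal.ofReal_lt_top hI.lt_top)
  · -- the pressure class
    refine ⟨hsw.distributional.2.2.1.aestronglyMeasurable.mono_measure
      (Measure.restrict_mono (parabolicCylinder_subset_slab a le_rfl) le_rfl), ?_⟩
    rw [eLpNorm_eq_lintegral_rpow_enorm_toReal (zero_lt_one.trans_le h32).ne' h32', h32r]
    refine ENNReal.rpow_lt_top_of_nonneg (by positivity) (ne_of_lt ?_)
    have hD := cknDOsc_le_abScaledSum.trans hbound
    refine lt_of_le_of_lt
      (lintegral_pressure_le_of_unitBallMean_eq_zero hsw.distributional.2.2.1 h0 ha) ?_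
    rw [← mul_assoc]
    exact ENNReal.mul_lt_top (pressureConst_lt_top a) (lt_of_le_of_lt hD hI.lt_top)

/-- **`‖v‖_{L³(Q(0,a))} ≤ (a² 𝐈)^{1/3}`** for a slab field (`C(Q(0,a)) ≤ 𝐈`; A–B (3.3)).
[cite: AlbrittonBarker2019, §3] -/
theorem eLpNorm_velocity_slab_le {a : ℝ} (ha : 0 < a) (p : ℝ → EuclideanSpace ℝ (Fin 3) → ℝ)
    (G : ℝ → EuclideanSpace ℝ (Fin 3) → EuclideanSpace ℝ (Fin 3) →L[ℝ] EuclideanSpace ℝ (Fin 3)) :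
    eLpNorm (uncurry u) 3 (volume.restrict (parabolicCylinder a (0 : ℝ × EuclideanSpace ℝ (Fin 3)))) ≤
      (ENNReal.ofReal a ^ 2 *
        typeIBound (Iio (0 : ℝ) ×ˢ (univ : Set (EuclideanSpace ℝ (Fin 3)))) u p G) ^ (1 / 3 : ℝ) := by
  have ha2 : ENNReal.ofReal a ^ 2 ≠ 0 := pow_ne_zero _ (ENNReal.ofReal_pos.2 ha).ne'
  have ha2' : ENNReal.ofReal a ^ 2 ≠ ∞ := ENNReal.pow_ne_top ENNReal.ofReal_ne_top
  have hC : cknC a 0 u ≤ typeIBound (Iio (0 : ℝ) ×ˢ (univ : Set (EuclideanSpace ℝ (Fin 3)))) u p G :=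
    (cknC_le_abScaledSum (p := p) (G := G)).trans
      (abScaledSum_le_typeIBound ha (parabolicCylinder_subset_lowerHalf le_rfl a))
  unfold cknC at hC
  have h' := (ENNReal.inv_mul_le_iff ha2 ha2').1 hC
  rw [eLpNorm_eq_lintegral_rpow_enorm_toReal (by norm_num) (by norm_num), ENNReal.toReal_ofNat]
  refine ENNReal.rpow_le_rpow ?_ (by norm_num)
  refine le_of_eq_of_le (lintegral_congr fun w => ?_) h'
  show ‖u w.1 w.2‖ₑ ^ (3 : ℝ) = ‖u w.1 w.2‖ₑ ^ (3 : ℕ)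
  rw [← ENNReal.rpow_natCast]
  norm_num

/-- **`‖q‖_{L^{3/2}(Q(0,a))} ≤ (2 (1 + |B_a| |B_1|⁻¹) a² 𝐈)^{2/3}`** for a normalised slab pressure,
`a ≥ 1` (`lintegral_pressure_le_of_unitBallMean_eq_zero` and `D(Q(0,a)) ≤ 𝐈`; A–B (3.3)).
[cite: AlbrittonBarker2019, §3] -/
theorem eLpNorm_pressure_slab_le
    (hp : LocallyIntegrableOn (uncurry p) (Iio (0 : ℝ) ×ˢ (univ : Set (EuclideanSpace ℝ (Fin 3)))) volume)
    (h0 : ∀ t, ⨍ y in ball (0 : EuclideanSpace ℝ (Fin 3)) 1, p t y = 0) {a : ℝ} (ha : 1 ≤ a)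
    (u : ℝ → EuclideanSpace ℝ (Fin 3) → EuclideanSpace ℝ (Fin 3))
    (G : ℝ → EuclideanSpace ℝ (Fin 3) → EuclideanSpace ℝ (Fin 3) →L[ℝ] EuclideanSpace ℝ (Fin 3)) :
    eLpNorm (uncurry p) (3 / 2) (volume.restrict (parabolicCylinder a (0 : ℝ × EuclideanSpace ℝ (Fin 3)))) ≤
      (2 * (1 + volume (ball (0 : EuclideanSpace ℝ (Fin 3)) a) * (volume (ball (0 : EuclideanSpace ℝ (Fin 3)) 1))⁻¹) *
        (ENNReal.ofReal a ^ 2 *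
          typeIBound (Iio (0 : ℝ) ×ˢ (univ : Set (EuclideanSpace ℝ (Fin 3)))) u p G)) ^ (2 / 3 : ℝ) := by
  obtain ⟨h32, h32', h32r⟩ := threeHalves_facts
  have ha0 : 0 < a := one_pos.trans_le ha
  have hD : cknDOsc a 0 p ≤ typeIBound (Iio (0 : ℝ) ×ˢ (univ : Set (EuclideanSpace ℝ (Fin 3)))) u p G :=
    (cknDOsc_le_abScaledSum (u := u) (G := G)).trans
      (abScaledSum_le_typeIBound ha0 (parabolicCylinder_subset_lowerHalf le_rfl a))
  rw [eLpNorm_eq_lintegral_rpow_enorm_toReal (zero_lt_one.trans_le h32).ne' h32', h32r,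
    show (1 / (3 / 2 : ℝ)) = 2 / 3 by norm_num]
  refine ENNReal.rpow_le_rpow ?_ (by norm_num)
  refine (lintegral_pressure_le_of_unitBallMean_eq_zero hp h0 ha).trans ?_
  gcongr

end Slab

end Literature.Analysis.FluidPDE
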